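import Literature.RingTheory.HilbertSamuel.ProjDirectrixLifts
import Mathlib.RingTheory.Nakayama
import Mathlib.LinearAlgebra.FiniteDimensional.Lemmas
import HarnessLib

/-!
# `e(A) = 1`: the directrix is a line — the exceptional ideal at a point of `ℙ(Dir(A))` is principal,
# and every element of `𝔪` is a multiple of its generator up to `(𝔪B)·𝔪_B` (CJS 2020, Def. 2.18 / Def. 6.34 (i), p. 103)

Topic: `Literature/RingTheory/HilbertSamuel`. Ring-level core of the tree proof of the named fact
`Literature.AlgebraicGeometry.CossartJannsenSaito2020.ProjDir_line` (CJS LNM 2270, Def. 6.34 (i) / p. 103: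
«`C_1 = ℙ(Dir_x(X)) ≅ ℙ^{t−1}_{k(x)}`», «if `e_x(X) ≤ 1` then `k(y) = k(x)`»), continuing `ProjDirectrixLifts.lean`.
Let `A` be a noetherian local ring with residue field `k`, `x_1, …, x_e` a minimal system of generators of `𝔪`,
`J = J_x ⊆ k[X_1, …, X_e]` the tangent cone ideal and `𝒯 = 𝒯(J) ⊆ S_1 = ⊕ k X_i` its directrix space
(`Literature.RingTheory.MvPolynomial.directrixSpace`, CJS Lemma 2.7), so that `e(A) = e − dim_k 𝒯`
(`finrank_directrixSpace_add_directrixDim`). For a linear combination `t = Σ a_i x_i ∈ 𝔪` write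
`ℓ(a) = Σ ā_i X_i ∈ S_1` for its symbol. Assume **`e(A) = 1`**, i.e. `𝒯` is a HYPERPLANE of `S_1`. PROVED:

* (private) `exists_sub_smul_mem_of_finrank_succ` — linear algebra: a hyperplane `T` of a finite-dimensional space
  `S` and a vector `ℓ ∈ S ∖ T` give `S = T ⊕ kℓ`: every `m ∈ S` is `m ≡ a ℓ (mod T)`;
* `exists_linForm_notMem_directrixSpace` — among ANY finite system of generators `c_1, …, c_r` of `𝔪` (with chosen
  expansions `c_k = Σ_i a_{ki} x_i`) some symbol `ℓ(a_k)` is NOT in `𝒯` (else all `X_i ∈ 𝒯`, by the minimality of `x`: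
  `mem_maximalIdeal_of_sum_mul_mem_sq`);
* `map_maximalIdeal_eq_span_of_projDirLiftsInto` — **the exceptional ideal is principal, generated by `t`**: for a
  ring homomorphism `φ : A → B` into a local ring with `φ(𝔪) ⊆ 𝔪_B` satisfying `ProjDirLiftsInto φ x`
  («`ξ ∈ ℙ(Dir(A))`», `ProjDirectrixLifts.lean`) and `t = Σ a_i x_i` with `ℓ(a) ∉ 𝒯`: `𝔪·B = φ(t)·B`. Indeed
  `X_i − ᾱ_i ℓ(a) ∈ 𝒯` lifts to `x_i − α_i t`, so `φ(x_i) ∈ φ(t)B + (𝔪B)𝔪_B`, and Nakayama applies;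
* `exists_forall_sub_mul_mem_of_projDirLiftsInto` — **ratios**: for every `y ∈ 𝔪` there is `β ∈ A`, depending only
  on `y` (not on `φ`), with `φ(y) − φ(β)φ(t) ∈ φ(t)·𝔪_B` for every such `φ` («`y/t ≡ β` at `ξ`»: the point of
  `ℙ(Dir) ≅ ℙ^0_k` is `k`-rational with coordinates read off in `A`).

These are the two algebraic facts behind «`ℙ(Dir_x(X))` is one `k(x)`-rational point when `e_x(X) = 1`»; the passage
to the blow-up `X' → X` (charts, uniqueness of the point, residue field) is
`Literature/AlgebraicGeometry/CossartJannsenSaito2020/ProjDirLine.lean`. Everything here is PROVED; no named facts.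

## References

* V. Cossart, U. Jannsen, S. Saito, *Desingularization: Invariants and Strategy*, LNM 2270 (2020), Lemma 2.7,
  Def. 2.18, Def. 2.26, Def. 6.34 (i), p. 103. [CossartJannsenSaito2020]
-/

noncomputable section

open IsLocalRing MvPolynomial Module
open Literature.AlgebraicGeometry.Resolution Literature.RingTheory.MvPolynomial

namespace Literature.RingTheory.HilbertSamuel

universe u v w

/-! ## Linear algebra: a hyperplane and a vector off it -/

section LinearAlgebra

variable {k : Type v} [Field k] {V : Type w} [AddCommGroup V] [Module k V]

/-- **A hyperplane and a vector off it span**: if `T ≤ S` are subspaces with `dim T + 1 = dim S < ∞` and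
`ℓ ∈ S ∖ T`, then every `m ∈ S` is congruent to a multiple of `ℓ` modulo `T`. [folklore] -/
private theorem exists_sub_smul_mem_of_finrank_succ {T S : Submodule k V} [FiniteDimensional k S] (hTS : T ≤ S)
    (hrank : finrank k T + 1 = finrank k S) {ℓ : V} (hℓS : ℓ ∈ S) (hℓT : ℓ ∉ T) {m : V} (hm : m ∈ S) :
    ∃ a : k, m - a • ℓ ∈ T := by
  haveI : FiniteDimensional k T := Submodule.finiteDimensional_of_le hTS
  have hℓ0 : ℓ ≠ 0 := fun h => hℓT (h ▸ T.zero_mem)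
  -- `T ⊓ kℓ = 0`
  have hinf : T ⊓ (k ∙ ℓ) = ⊥ := by
    refine (Submodule.eq_bot_iff _).mpr fun v hv => ?_
    obtain ⟨hvT, hvℓ⟩ := Submodule.mem_inf.mp hv
    obtain ⟨a, rfl⟩ := Submodule.mem_span_singleton.mp hvℓ
    by_cases ha : a = 0
    · rw [ha, zero_smul]
    · exact absurd (by simpa [smul_smul, inv_mul_cancel₀ ha] using T.smul_mem a⁻¹ hvT) hℓT
  -- `T ⊔ kℓ = S` by a dimension count
  have hsup : T ⊔ (k ∙ ℓ) = S := by
    have hle : T ⊔ (k ∙ ℓ) ≤ S := sup_le hTS ((Submodule.span_singleton_le_iff_mem ℓ S).mpr hℓS)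
    haveI : FiniteDimensional k ↥(T ⊔ (k ∙ ℓ)) := Submodule.finiteDimensional_of_le hle
    refine Submodule.eq_of_le_of_finrank_le hle ?_
    have h := Submodule.finrank_sup_add_finrank_inf_eq T (k ∙ ℓ)
    rw [hinf, finrank_bot, add_zero, finrank_span_singleton hℓ0] at h
    rw [h, hrank]
  rw [← hsup] at hm
  obtain ⟨y, hy, z, hz, rfl⟩ := Submodule.mem_sup.mp hm
  obtain ⟨a, rfl⟩ := Submodule.mem_span_singleton.mp hz
  exact ⟨a, by rwa [add_sub_cancel_right]⟩

end LinearAlgebra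

/-! ## Linear forms: coefficients -/

section LinearForms

variable {k : Type v} [Field k] {e : ℕ}

/-- The `X_i`-coefficient of `Σ v_j X_j` is `v_i`. [folklore] -/
private theorem coeff_single_one_linForm (v : Fin e → k) (i : Fin e) :
    MvPolynomial.coeff (Finsupp.single i 1) (linForm v) = v i := by
  classical
  rw [linForm_apply, MvPolynomial.coeff_sum]
  simp_rw [MvPolynomial.coeff_smul, MvPolynomial.coeff_X, smul_eq_mul]
  rw [Finset.sum_eq_single i]
  · simp
  · intro j _ hj
    rw [if_neg, mul_zero]
    exact fun h => hj (Finsupp.single_left_injective one_ne_zero h)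
  · exact fun h => absurd (Finset.mem_univ i) h

/-- `linForm` is `k`-linear in the coefficient vector (sum form). [folklore] -/
private theorem linForm_sum_smul {ι : Type*} (s : Finset ι) (r : ι → k) (v : ι → Fin e → k) :
    linForm (fun i => ∑ l ∈ s, r l * v l i) = ∑ l ∈ s, r l • linForm (v l) := by
  have h : (fun i => ∑ l ∈ s, r l * v l i) = ∑ l ∈ s, r l • v l := by
    funext i
    simp [Finset.sum_apply, Pi.smul_apply, smul_eq_mul]
  rw [h, map_sum]
  exact Finset.sum_congr rfl fun l _ => by rw [map_smul]

end LinearForms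

/-! ## `e(A) = 1`: a generator of `𝔪` off the directrix hyperplane -/

section Line

variable {A : Type u} [CommRing A] [IsLocalRing A] {e : ℕ} {x : Fin e → A}
  (hx : Ideal.span (Set.range x) = maximalIdeal A) (he : (maximalIdeal A).spanFinrank = e)

include he in
/-- **Among any generators `c_1, …, c_r` of `𝔪`, some symbol lies off the directrix** when `e(A) ≥ 1`:
with expansions `c_l = Σ_i a_{li} x_i` in the minimal system `x`, some `ℓ(a_l) = Σ_i ā_{li} X_i ∉ 𝒯(J_x)`. Otherwise,
writing `x_i = Σ_l b_{il} c_l`, the relation `Σ_j ((ba)_{ij} − δ_{ij}) x_j = 0` has coefficients in `𝔪`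
(`mem_maximalIdeal_of_sum_mul_mem_sq`), so `X_i = Σ_l b̄_{il} ℓ(a_l) ∈ 𝒯` for all `i` and `𝒯 = S_1`, `e(A) = 0`.
[cite: CossartJannsenSaito2020, Lemma 2.7, Def. 2.18] -/
theorem exists_linForm_notMem_directrixSpace [IsNoetherianRing A] (hd : 0 < directrixDim (tangentConeIdeal x hx))
    {r : ℕ} {c : Fin r → A} (hc : Ideal.span (Set.range c) = maximalIdeal A)
    (a : Fin r → Fin e → A) (hca : ∀ l, c l = ∑ i, a l i * x i) :
    ∃ l, linForm (fun i => residue A (a l i)) ∉ directrixSpace (tangentConeIdeal x hx) := by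
  classical
  by_contra hall
  simp only [not_exists, not_not] at hall
  set T := directrixSpace (tangentConeIdeal x hx) with hT
  -- `x_i = Σ_l b_{il} c_l`
  have hxi : ∀ i, ∃ b : Fin r → A, ∑ l, b l * c l = x i := fun i =>
    Ideal.mem_span_range_iff_exists_fun.mp (by rw [hc, ← hx]; exact Ideal.subset_span ⟨i, rfl⟩)
  choose b hb using hxi
  -- every `X_i` lies in `T`
  have hX : ∀ i, (X i : MvPolynomial (Fin e) (ResidueField A)) ∈ T := by
    intro i
    -- the matrix `M = b a` satisfies `Σ_j (M_{ij} - δ_{ij}) x_j = 0`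
    have hrel : ∑ j, ((∑ l, b i l * a l j) - if j = i then 1 else 0) * x j ∈ maximalIdeal A ^ 2 := by
      have h0 : ∑ j, ((∑ l, b i l * a l j) - if j = i then 1 else 0) * x j = 0 := by
        simp only [sub_mul, Finset.sum_sub_distrib]
        rw [sub_eq_zero]
        have h1 : ∑ j, (∑ l, b i l * a l j) * x j = x i := by
          rw [← hb i]
          simp_rw [Finset.sum_mul, mul_assoc]
          rw [Finset.sum_comm]
          exact Finset.sum_congr rfl fun l _ => by rw [← Finset.mul_sum, ← hca l]
        rw [h1, Finset.sum_eq_single i (fun j _ hj => by rw [if_neg hj, zero_mul])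
          (fun h => absurd (Finset.mem_univ i) h), if_pos rfl, one_mul]
      rw [h0]
      exact zero_mem _
    have hcoef : ∀ j, residue A (∑ l, b i l * a l j) = if j = i then 1 else 0 := by
      intro j
      have h := mem_maximalIdeal_of_sum_mul_mem_sq hx he hrel j
      rw [← residue_eq_zero_iff, map_sub, sub_eq_zero] at h
      rw [h]
      split_ifs <;> simp
    -- `X_i = Σ_l b̄_{il} ℓ(a_l)`
    have hXi : (X i : MvPolynomial (Fin e) (ResidueField A)) =
        ∑ l, residue A (b i l) • linForm (fun j => residue A (a l j)) := by
      rw [← linForm_sum_smul Finset.univ (fun l => residue A (b i l)) (fun l j => residue A (a l j)),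
        ← linForm_single i]
      congr 1
      funext j
      rw [Pi.single_apply, ← hcoef j, map_sum]
      exact Finset.sum_congr rfl fun l _ => map_mul _ _ _
    rw [hXi]
    exact T.sum_mem fun l _ => T.smul_mem _ (hall l)
  -- hence `S_1 ≤ T` and `e(A) = 0`
  have hS : homogeneousSubmodule (Fin e) (ResidueField A) 1 ≤ T := by
    rw [homogeneousSubmodule_one_eq_span_X, Submodule.span_le]
    rintro _ ⟨i, rfl⟩
    exact hX i
  have hfin := finrank_directrixSpace_add_directrixDim (tangentConeIdeal x hx)
  rw [← hT] at hfin
  haveI : FiniteDimensional (ResidueField A) T :=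
    Submodule.finiteDimensional_of_le (directrixSpace_le_one (tangentConeIdeal x hx))
  have hle : finrank (ResidueField A) (homogeneousSubmodule (Fin e) (ResidueField A) 1) ≤
      finrank (ResidueField A) T := Submodule.finrank_mono hS
  rw [finrank_homogeneousSubmodule_one] at hle
  omega

/-! ## `e(A) = 1`: the exceptional ideal at a point of `ℙ(Dir)` is principal -/

variable {B : Type w} [CommRing B] [IsLocalRing B]

/-- **The directrix forms adapted to `t`.** If `e(A) = 1` and `ℓ(a) ∉ 𝒯` for `t = Σ a_i x_i`, then for each `i` there
is `α_i ∈ A` such that the linear form `X_i − ᾱ_i ℓ(a)` lies in `𝒯`; consequently, for every `φ : A → B` into a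
local ring with `φ(𝔪) ⊆ 𝔪_B` and `ProjDirLiftsInto φ x` one has `φ(x_i) − φ(α_i)φ(t) ∈ (𝔪B)·𝔪_B` (the lift
`x_i − α_i t` of that form). The `α_i` do not depend on `φ`. [cite: CossartJannsenSaito2020, Def. 6.34 (i), p. 103] -/
theorem exists_forall_map_sub_mul_mem (hd : directrixDim (tangentConeIdeal x hx) = 1)
    {t : A} {a : Fin e → A} (hta : t = ∑ i, a i * x i)
    (hℓ : linForm (fun i => residue A (a i)) ∉ directrixSpace (tangentConeIdeal x hx)) (i : Fin e) :
    ∃ α : A, ∀ (B : Type w) [CommRing B] [IsLocalRing B] (φ : A →+* B),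
      (maximalIdeal A).map φ ≤ maximalIdeal B → ProjDirLiftsInto φ x hx →
        φ (x i) - φ α * φ t ∈ (maximalIdeal A).map φ * maximalIdeal B := by
  classical
  set T := directrixSpace (tangentConeIdeal x hx) with hT
  set S := homogeneousSubmodule (Fin e) (ResidueField A) 1 with hS
  haveI : FiniteDimensional (ResidueField A) S := by
    rw [hS, ← range_linForm]; infer_instance
  have hTS : T ≤ S := directrixSpace_le_one _
  have hrank : finrank (ResidueField A) T + 1 = finrank (ResidueField A) S := by
    rw [hS, finrank_homogeneousSubmodule_one, ← hd]
    exact finrank_directrixSpace_add_directrixDim _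
  have hℓS : linForm (fun i => residue A (a i)) ∈ S := by
    rw [hS, ← range_linForm]; exact LinearMap.mem_range_self _ _
  have hXS : (X i : MvPolynomial (Fin e) (ResidueField A)) ∈ S := by rw [hS]; exact isHomogeneous_X _ i
  obtain ⟨abar, habar⟩ := exists_sub_smul_mem_of_finrank_succ hTS hrank hℓS hℓ hXS
  obtain ⟨α, rfl⟩ : ∃ α, residue A α = abar := Ideal.Quotient.mk_surjective abar
  refine ⟨α, fun B _ _ φ hφ hP => ?_⟩
  -- the lift `x_i − α t = Σ_m (δ_{im} − α a_m) x_m` of the form `X_i − ᾱ ℓ(a)`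
  let cf : Fin e → A := fun m => (if m = i then 1 else 0) - α * a m
  have hcf : ∀ m, residue A (cf m) = MvPolynomial.coeff (Finsupp.single m 1)
      ((X i : MvPolynomial (Fin e) (ResidueField A)) - residue A α • linForm fun i => residue A (a i)) := by
    intro m
    simp only [cf, MvPolynomial.coeff_sub, MvPolynomial.coeff_smul, coeff_single_one_linForm,
      MvPolynomial.coeff_X, map_sub, map_mul, smul_eq_mul]
    by_cases hmi : m = i
    · subst hmi
      rw [if_pos rfl, if_pos rfl, map_one]
    · rw [if_neg hmi, if_neg (fun h => hmi (Finsupp.single_left_injective one_ne_zero h).symm), map_zero]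
  have hval : ∑ m, cf m * x m = x i - α * t := by
    simp only [cf, sub_mul, Finset.sum_sub_distrib]
    congr 1
    · rw [Finset.sum_eq_single i (fun j _ hj => by rw [if_neg hj, zero_mul])
        (fun h => absurd (Finset.mem_univ i) h), if_pos rfl, one_mul]
    · rw [hta, Finset.mul_sum]
      exact Finset.sum_congr rfl fun m _ => by ring
  have h := hP _ habar cf hcf
  rwa [hval, map_sub, map_mul] at h

/-- **`𝔪·B = φ(t)·B` at a point of `ℙ(Dir(A))` when `e(A) = 1`** (CJS p. 103: the exceptional divisor at the unique
point of `C_1 = ℙ(Dir_x) ≅ ℙ^0` is cut out by one parameter): for `φ : A → B` into a local ring, `φ(𝔪) ⊆ 𝔪_B`,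
`ProjDirLiftsInto φ x`, and `t = Σ a_i x_i ∈ 𝔪` with symbol `ℓ(a) ∉ 𝒯`, the ideal `𝔪B` is generated by `φ(t)`.
Proof: `φ(x_i) ∈ φ(t)B + (𝔪B)𝔪_B` for all `i` (`exists_forall_map_sub_mul_mem`), and Nakayama.
[cite: CossartJannsenSaito2020, Def. 6.34 (i), p. 103] -/
theorem map_maximalIdeal_eq_span_of_projDirLiftsInto (hd : directrixDim (tangentConeIdeal x hx) = 1)
    {t : A} {a : Fin e → A} (hta : t = ∑ i, a i * x i)
    (hℓ : linForm (fun i => residue A (a i)) ∉ directrixSpace (tangentConeIdeal x hx))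
    (φ : A →+* B) (hφ : (maximalIdeal A).map φ ≤ maximalIdeal B) (hP : ProjDirLiftsInto φ x hx) :
    (maximalIdeal A).map φ = Ideal.span {φ t} := by
  classical
  have ht : t ∈ maximalIdeal A := by
    rw [hta, ← hx]
    exact Ideal.sum_mem _ fun i _ => Ideal.mul_mem_left _ _ (Ideal.subset_span ⟨i, rfl⟩)
  apply le_antisymm
  · -- Nakayama
    set N : Ideal B := (maximalIdeal A).map φ with hN
    have hNfg : N.FG := by
      rw [hN, ← hx, Ideal.map_span]
      exact ⟨(Finset.univ.image (φ ∘ x)), by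
        rw [Finset.coe_image, Finset.coe_univ, Set.image_univ, Set.range_comp]⟩
    have hle : N ≤ Ideal.span {φ t} ⊔ maximalIdeal B • N := by
      rw [hN, ← hx, Ideal.map_span, Ideal.span_le]
      rintro _ ⟨_, ⟨i, rfl⟩, rfl⟩
      obtain ⟨α, hα⟩ := exists_forall_map_sub_mul_mem hx hd hta hℓ i
      have hmem := hα B φ hφ hP
      have : φ (x i) = φ α * φ t + (φ (x i) - φ α * φ t) := by ring
      rw [this]
      refine Submodule.add_mem_sup (Ideal.mul_mem_left _ _ (Ideal.mem_span_singleton_self _)) ?_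
      rw [Ideal.smul_eq_mul, mul_comm (maximalIdeal B), ← Ideal.map_span, hx]
      exact hmem
    exact Submodule.le_of_le_smul_of_le_jacobson_bot hNfg (IsLocalRing.maximalIdeal_le_jacobson ⊥) hle
  · rw [Ideal.span_le, Set.singleton_subset_iff]
    exact Ideal.mem_map_of_mem φ ht

/-- **Ratios `y/t` at a point of `ℙ(Dir(A))`, `e(A) = 1`.** For every `y ∈ 𝔪` there is `β ∈ A` — depending on
`y` only — such that for every `φ : A → B` into a local ring with `φ(𝔪) ⊆ 𝔪_B` and `ProjDirLiftsInto φ x`: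
`φ(y) − φ(β)φ(t) ∈ φ(t)·𝔪_B` (with `t`, `ℓ(a) ∉ 𝒯` as above). Writing `y = Σ y_i x_i`, `β = Σ y_i α_i`.
In the blow-up chart this says that the regular function `y/t` takes the value `β̄ ∈ k` at the point: the point of
`ℙ(Dir) ≅ ℙ^0_k` is `k`-rational with coordinates computed in `A`. [cite: CossartJannsenSaito2020, Def. 6.34 (i), p. 103] -/
theorem exists_forall_sub_mul_mem_of_projDirLiftsInto (hd : directrixDim (tangentConeIdeal x hx) = 1)
    {t : A} {a : Fin e → A} (hta : t = ∑ i, a i * x i)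
    (hℓ : linForm (fun i => residue A (a i)) ∉ directrixSpace (tangentConeIdeal x hx))
    {y : A} (hy : y ∈ maximalIdeal A) :
    ∃ β : A, ∀ (B : Type w) [CommRing B] [IsLocalRing B] (φ : A →+* B),
      (maximalIdeal A).map φ ≤ maximalIdeal B → ProjDirLiftsInto φ x hx →
        φ y - φ β * φ t ∈ Ideal.span {φ t} * maximalIdeal B := by
  classical
  -- `y = Σ y_i x_i`
  obtain ⟨yc, hyc⟩ : ∃ yc : Fin e → A, ∑ i, yc i * x i = y :=
    Ideal.mem_span_range_iff_exists_fun.mp (by rw [hx]; exact hy)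
  have hαi := fun i => exists_forall_map_sub_mul_mem.{u, w} hx hd hta hℓ i
  choose α hα using hαi
  refine ⟨∑ i, yc i * α i, fun B _ _ φ hφ hP => ?_⟩
  have hspan := map_maximalIdeal_eq_span_of_projDirLiftsInto hx hd hta hℓ φ hφ hP
  have hdec : φ y - φ (∑ i, yc i * α i) * φ t = ∑ i, φ (yc i) * (φ (x i) - φ (α i) * φ t) := by
    rw [← hyc, map_sum, map_sum, Finset.sum_mul]
    simp only [map_mul, mul_sub, Finset.sum_sub_distrib]
    congr 1
    exact Finset.sum_congr rfl fun i _ => by ring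
  rw [hdec]
  refine Ideal.sum_mem _ fun i _ => Ideal.mul_mem_left _ _ ?_
  have h := hα i B φ hφ hP
  rwa [hspan] at h

end Line

end Literature.RingTheory.HilbertSamuel

end
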